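/-
Copyright (c) 2026 the pub-hodgecm-mathlib formalisation cell (harness21).  Prover seat hodgecm-mathlib-A-p19 (g19), topic T5 = P8
«(C♯)hol interior», node Cc (J-plc) brick (J-plc-G) (desk F0P2-plan (g8) «=» 20:14:40Z: report-first).  KERNEL: theorems only.
-/
import Literature.NumberTheory.GelbartRogawski1991.DoubledWeilRepresentationArchPlaceVacuum
import Literature.NumberTheory.Automorphic.Liu2021.Def411WeilCarriersCentralTypeGaussian
import HarnessLib

/-!
# One definite archimedean place through the splitting attached to `χ`, ON THE GAUSSIAN: `(u at w(v₀), 1)` acts on `G_𝕍 ⊗ f` by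
# `((det u)^M)^{(τ_{w(v₀)} ± 1)/2}` ([KonnoKonno2007, Lem. 5.2]; [GelbartRogawski1991, §3.1]; [Liu2021, Lem. D.2 (1)])

Topic `NumberTheory/Automorphic/Liu2021` (T5 = P8 «(C♯)hol interior», node Cc (J-plc)); namespace
`Literature.NumberTheory.GelbartRogawski1991.GRConstruction`.  KERNEL ONLY: proved theorems; 0 definitions, 0 records, 0 `sorry`.
The ONE-PLACE analogue of ★ `Def411WeilCarriersCentralTypeGaussian` §1/§3 (which reads the CENTRE `(t·1_V, 1)`): for `χ` unitary with
`χ|_{𝕀_{L⁺}} = ε` and odd unitary archimedean type `(τ, 0)`, a real place `v₀` at which the pair form `diag dV ⊗ diag dW` is DEFINITE, and ANY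
`u ∈ U(σ_{w(v₀)} diag dV)(ℂ)`, the pair element `(u at w(v₀), 1 elsewhere; 1_W)` acts through `ω ∘ ι_χ` (`ι_χ = chiSplitting χ`) on every pure tensor
`G_𝕍 ⊗ f` by the SCALAR `η_τ(k_{v₀,u}) · vac (sectionD k_{v₀,u})` (`omega_chiSplitting_placePair_gaussianV_tmul` — undoubling ★ (A5) of the doubled
vacuum character at the one-place element, bricks (ii)(iii)), i.e. by `((det u)^M)^{(τ_{w(v₀)}+1)/2}` if the form is POSITIVE at `v₀` and
`((det u)^M)^{(τ_{w(v₀)}−1)/2}` if NEGATIVE (`…_of_pos ∕ …_of_neg`); and the same AT THE HERMITIAN LINE `⟨T_W⟩` through `chiSplittingLine`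
(`pairRep_chiSplittingLine_archSingle_gaussianV_tmul_of_pos ∕ _of_neg`).  This is the (J-plc-G) statement of `F0/P2/T5a-TREE.md` §2b: on the
Gaussian line the `U(V_w)`-type of `ω_χ` at a definite place `w ≠ w(ι)` is the character `det^{m_w}`, `m_w = (τ_w ± 1)/2 · M` — the input of node Cc's
«χ_w-isotypic on R_w ⊗ 𝓢(V_f) ⇒ exponent ∓1» once (3′) (Gaussian line ⇒ all of 𝓢 at the place) is supplied.

HONEST SCOPE.  Statements about the tree's own Weil-representation terms; nothing of [Liu2021] is asserted; HC_CM is NOT proved here or anywhere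
in the tree.

References: [KonnoKonno2007] Lemma 5.2; [GelbartRogawski1991] §3.1 Prop. 3.1.1, Remark p. 457; [Kudla1994] §3 Thm. 3.1; [Folland1989] Prop. (4.39).
-/

set_option autoImplicit false

noncomputable section

open scoped Classical
open scoped Matrix Kronecker TensorProduct SchwartzMap
open NumberField NumberField.InfinitePlace NumberField.mixedEmbedding IsDedekindDomain
open Literature.RepresentationTheory.HeisenbergGroup
open Literature.NumberTheory.Automorphic Literature.NumberTheory.Automorphic.UnitaryGroup
open Literature.NumberTheory.Weil1964
open Literature.RepresentationTheory.HarrisKudlaSweet1996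
open Literature.NumberTheory.GaloisRepresentations
open Literature.Analysis.SegalBargmann

namespace Literature.NumberTheory.GelbartRogawski1991.GRConstruction

open UnitaryDualPair UnitaryDualPair.ArchSplitting
open Literature.NumberTheory.GelbartRogawski1991.UnitaryDualPair.LocalSplitting
open Literature.NumberTheory.Automorphic.Liu2021.Def411WeilCarriersDoubling (doubledWeilRep chiSplitting isDoubledWeilRep_doubledWeilRep)

variable (L : Type) [Field L] [NumberField L] [IsCMField L]

variable {N M n : ℕ} (e : Fin N × Fin M ≃ Fin n)
  (dV : Fin N → L) (hdV : ∀ i, IsCMField.complexConj L (dV i) = dV i) (hdV0 : ∀ i, dV i ≠ 0)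
  (dW : Fin M → L) (hdW : ∀ i, IsCMField.complexConj L (dW i) = dW i) (hdW0 : ∀ i, dW i ≠ 0)
  (v₀ : {v : InfinitePlace (Fp L) // v.IsReal})

/-! ## §1 The undoubled eigenvalue on the Gaussian at the one-place element -/

section Assembly

set_option maxHeartbeats 2000000 in
-- (as in ★ `omega_chiSplitting_centerPair_gaussianV_tmul`: the `show`/`refine` steps unify `chiSplitting χ g` with `undouble … g` through the doubled telescope)
/-- **ONE DEFINITE PLACE THROUGH THE SPLITTING ATTACHED TO `χ`, ON THE GAUSSIAN**: for `χ` unitary with `χ|_{𝕀_{L⁺}} = ε` and odd unitary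
archimedean type `(τ, 0)`, a real place `v₀` at which the pair sign vector is constant, and `u ∈ U(σ_{w(v₀)} diag dV)(ℂ)`, the element
`(u at w(v₀)) ⊗ 1_W` acts through `ι_χ = chiSplitting χ` on every pure tensor `G_𝕍 ⊗ f` by the SCALAR `η_τ(k_{v₀,u}) · vac (sectionD k_{v₀,u})`.
[cite: GelbartRogawski1991, §3.1 Prop. 3.1.1 p. 455, Remark p. 457 L9–13] [cite: Kudla1994, §3 Thm. 3.1] [cite: Folland1989, §4.2 Prop. (4.39)]
[cite: KonnoKonno2007, Lemma 5.2 p. 73] -/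
theorem omega_chiSplitting_placePair_gaussianV_tmul {χ : HeckeCharacter L} (hχu : χ.IsUnitary) (hχs : IsSplittingChar L 1 χ)
    {τ : InfinitePlace L → ℤ} (hτ : χ.HasUnitaryArchType τ 0) (hodd : ∀ w, Odd (τ w))
    (u : UnitaryGroup.archLocal L N (Matrix.diagonal dV) (cmPlaceOver L v₀))
    (hdef : ∀ k k' : Fin n, (0 < signVec (cmPlaceOver L) (cmGramEntry L e dV hdV dW hdW) (imagUnit L) v₀ k ↔
      0 < signVec (cmPlaceOver L) (cmGramEntry L e dV hdV dW hdW) (imagUnit L) v₀ k'))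
    (f : FinSB (Fp L) (Fin n)) :
    adelicMpCont.omega (Fp L) (Fin n) (gramA L e dV hdV dW hdW)
        (chiSplitting L e dV hdV hdV0 dW hdW hdW0 χ hχu hχs (placePair L dV dW v₀ u))
        (piSchwartzBruhatEquiv (Fp L) (Fin n) (gaussianV L e dV hdV hdV0 dW hdW hdW0 ⊗ₜ f)) =
      ((((etaD L e dV hdV dW hdW τ (archKPlace L e dV hdV dW hdW v₀ u) : ℂˣ) : ℂ)) *
          MpS.vac (sectionD L e dV hdV hdV0 dW hdW hdW0 (archKPlace L e dV hdV dW hdW v₀ u))) •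
        piSchwartzBruhatEquiv (Fp L) (Fin n) (gaussianV L e dV hdV hdV0 dW hdW hdW0 ⊗ₜ f) := by
  have hu := (exists_proj_sectionD_archKPlace L e dV hdV hdV0 dW hdW hdW0 v₀ u hdef).choose_spec
  show adelicMpCont.omega (Fp L) (Fin n) (gramA L e dV hdV dW hdW)
      (undouble L e dV hdV hdV0 dW hdW hdW0 (isDoubledWeilRep_doubledWeilRep L e dV hdV hdV0 dW hdW hdW0 χ hχu hχs).proj_eq
        (placePair L dV dW v₀ u)) _ = _
  have h1 : doubledWeilRep L e dV hdV hdV0 dW hdW hdW0 χ hχu hχs (inlG L e dV hdV dW hdW (placePair L dV dW v₀ u)) =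
      archHalfOf L e dV hdV hdV0 dW hdW hdW0 τ (archKPlace L e dV hdV dW hdW v₀ u) :=
    (DFunLike.congr_arg (doubledWeilRep L e dV hdV hdV0 dW hdW hdW0 χ hχu hχs) (archToAdelic_archKPlace L e dV hdV dW hdW v₀ u)).symm.trans
      (doubledWeilRep_archToAdelic_eq_archHalfOf L e dV hdV hdV0 dW hdW hdW0 hχu hχs hτ hodd (archKPlace L e dV hdV dW hdW v₀ u))
  have hrew : ∀ (a : 𝓢((Fin (n + n) → mixedSpace (Fp L)), ℂ)) (f' : FinSB (Fp L) (Fin (n + n))),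
      adelicMpCont.omega (Fp L) (Fin (n + n)) (gramDA L e dV hdV dW hdW)
          (doubledWeilRep L e dV hdV hdV0 dW hdW hdW0 χ hχu hχs (inlG L e dV hdV dW hdW (placePair L dV dW v₀ u)))
          (piSchwartzBruhatEquiv (Fp L) (Fin (n + n)) (a ⊗ₜ f')) =
        adelicMpCont.omega (Fp L) (Fin (n + n)) (gramDA L e dV hdV dW hdW)
          (archHalfOf L e dV hdV hdV0 dW hdW hdW0 τ (archKPlace L e dV hdV dW hdW v₀ u))
          (piSchwartzBruhatEquiv (Fp L) (Fin (n + n)) (a ⊗ₜ f')) := fun a f' =>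
    congrArg (fun q : MpD L e dV hdV dW hdW =>
      adelicMpCont.omega (Fp L) (Fin (n + n)) (gramDA L e dV hdV dW hdW) q (piSchwartzBruhatEquiv (Fp L) (Fin (n + n)) (a ⊗ₜ f'))) h1
  by_cases hf : f = 0
  · subst hf
    simp only [TensorProduct.tmul_zero, map_zero, smul_zero]
  refine omega_undouble_tmul_eq_smul_of_arch L e dV hdV hdV0 dW hdW hdW0 _ _ (placePair L dV dW v₀ u)
    (fun a f' => (hrew a f').trans (omega_archHalfOf_tmul L e dV hdV hdV0 dW hdW hdW0 τ (archKPlace L e dV hdV dW hdW v₀ u) a f'))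
    (gaussianV L e dV hdV hdV0 dW hdW hdW0) (gaussianV L e dV hdV hdV0 dW hdW hdW0) f f ?_
    (piSchwartzBruhatEquiv_tmul_ne_zero (gaussianV_ne_zero L e dV hdV hdV0 dW hdW hdW0) hf)
  rw [schwartzReindexCLM_archBoxTensor_gaussianV]
  rw [follandHermite, carrierConjEquiv_apply, ContinuousLinearEquiv.apply_symm_apply,
    MpS.apply_hermitePi_zero_of_proj_eq_realifySp hu, map_smul]

/-- **the scalar, pair form POSITIVE at `v₀`: `((det u)^M)^{(τ_{w(v₀)}+1)/2}`** (bricks (ii)(iii): `η_τ = ((det u)^M)^{(τ+1)/2}`, `vac = 1`).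
[cite: KonnoKonno2007, Lemma 5.2 p. 73] -/
theorem etaD_mul_vac_archKPlace_of_pos (τ : InfinitePlace L → ℤ) (u : UnitaryGroup.archLocal L N (Matrix.diagonal dV) (cmPlaceOver L v₀))
    (hpos : ∀ k : Fin n, 0 < signVec (cmPlaceOver L) (cmGramEntry L e dV hdV dW hdW) (imagUnit L) v₀ k) :
    (((etaD L e dV hdV dW hdW τ (archKPlace L e dV hdV dW hdW v₀ u) : ℂˣ) : ℂ)) *
        MpS.vac (sectionD L e dV hdV hdV0 dW hdW hdW0 (archKPlace L e dV hdV dW hdW v₀ u)) =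
      (((((u : UnitaryGroup.archLocal L N (Matrix.diagonal dV) (cmPlaceOver L v₀)) : GL (Fin N) ℂ) : Matrix (Fin N) (Fin N) ℂ).det) ^ M) ^
        ((τ (cmPlaceOver L v₀).1 + 1) / 2) := by
  rw [coe_etaD_archKPlace, vac_sectionD_archKPlace_of_pos L e dV hdV hdV0 dW hdW hdW0 v₀ u hpos, mul_one]

/-- **the scalar, pair form NEGATIVE at `v₀`: `((det u)^M)^{(τ_{w(v₀)}−1)/2}`** (bricks (ii)(iii): `η_τ = ((det u)^M)^{(τ+1)/2}`, `vac = ((det u)^M)⁻¹`;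
`τ` odd). [cite: KonnoKonno2007, Lemma 5.2 p. 73] -/
theorem etaD_mul_vac_archKPlace_of_neg {τ : InfinitePlace L → ℤ} (hodd : ∀ w, Odd (τ w))
    (u : UnitaryGroup.archLocal L N (Matrix.diagonal dV) (cmPlaceOver L v₀))
    (hneg : ∀ k : Fin n, ¬ 0 < signVec (cmPlaceOver L) (cmGramEntry L e dV hdV dW hdW) (imagUnit L) v₀ k) :
    (((etaD L e dV hdV dW hdW τ (archKPlace L e dV hdV dW hdW v₀ u) : ℂˣ) : ℂ)) *
        MpS.vac (sectionD L e dV hdV hdV0 dW hdW hdW0 (archKPlace L e dV hdV dW hdW v₀ u)) =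
      (((((u : UnitaryGroup.archLocal L N (Matrix.diagonal dV) (cmPlaceOver L v₀)) : GL (Fin N) ℂ) : Matrix (Fin N) (Fin N) ℂ).det) ^ M) ^
        ((τ (cmPlaceOver L v₀).1 - 1) / 2) := by
  rw [coe_etaD_archKPlace, vac_sectionD_archKPlace_of_neg L e dV hdV hdV0 dW hdW hdW0 v₀ u hneg]
  have hdet : ((((u : UnitaryGroup.archLocal L N (Matrix.diagonal dV) (cmPlaceOver L v₀)) : GL (Fin N) ℂ) : Matrix (Fin N) (Fin N) ℂ).det) ^ M ≠ 0 :=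
    pow_ne_zero _ (((u : UnitaryGroup.archLocal L N (Matrix.diagonal dV) (cmPlaceOver L v₀)) : GL (Fin N) ℂ).isUnit.map Matrix.detMonoidHom).ne_zero
  obtain ⟨m, hm⟩ := hodd (cmPlaceOver L v₀).1
  have h1 : (τ (cmPlaceOver L v₀).1 + 1) / 2 = m + 1 := by omega
  have h2 : (τ (cmPlaceOver L v₀).1 - 1) / 2 = m := by omega
  rw [h1, h2, ← zpow_neg_one, ← zpow_add₀ hdet]
  congr 1
  ring

end Assembly

/-! ## §2 The pair representation at `(adelicSingle (w(v₀)) u, 1)` and the hermitian line -/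

section Pair

/-- **ONE DEFINITE PLACE THROUGH `pairRep … (chiSplitting χ)`, POSITIVE sign**: `(adelicSingle (w(v₀)) u, 1)` acts on `G_𝕍 ⊗ f` by
`((det u)^M)^{(τ_{w(v₀)}+1)/2}`. [cite: GelbartRogawski1991, §3.1 Prop. 3.1.1 p. 455] [cite: KonnoKonno2007, Lemma 5.2 p. 73] -/
theorem pairRep_chiSplitting_adelicSingle_gaussianV_tmul_of_pos {χ : HeckeCharacter L} (hχu : χ.IsUnitary) (hχs : IsSplittingChar L 1 χ)
    {τ : InfinitePlace L → ℤ} (hτ : χ.HasUnitaryArchType τ 0) (hodd : ∀ w, Odd (τ w))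
    (u : UnitaryGroup.archLocal L N (Matrix.diagonal dV) (cmPlaceOver L v₀))
    (hpos : ∀ k : Fin n, 0 < signVec (cmPlaceOver L) (cmGramEntry L e dV hdV dW hdW) (imagUnit L) v₀ k) (f : FinSB (Fp L) (Fin n)) :
    pairRep (Fp L) L (IsCMField.complexConj L) N M e (Matrix.diagonal dV) (Matrix.diagonal dW)
        (chiSplitting L e dV hdV hdV0 dW hdW hdW0 χ hχu hχs)
        (UnitaryGroup.adelicSingle (Fp L) L (IsCMField.complexConj L) N (Matrix.diagonal dV) (IsCMField.complexConj_ne_one L)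
          (complexConj_smul_infinitePlace L) (cmPlaceOver L v₀) u, 1)
        (piSchwartzBruhatEquiv (Fp L) (Fin n) (gaussianV L e dV hdV hdV0 dW hdW hdW0 ⊗ₜ f)) =
      (((((u : UnitaryGroup.archLocal L N (Matrix.diagonal dV) (cmPlaceOver L v₀)) : GL (Fin N) ℂ) : Matrix (Fin N) (Fin N) ℂ).det) ^ M) ^
        ((τ (cmPlaceOver L v₀).1 + 1) / 2) •
        piSchwartzBruhatEquiv (Fp L) (Fin n) (gaussianV L e dV hdV hdV0 dW hdW hdW0 ⊗ₜ f) := by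
  have hdef : ∀ k k' : Fin n, (0 < signVec (cmPlaceOver L) (cmGramEntry L e dV hdV dW hdW) (imagUnit L) v₀ k ↔
      0 < signVec (cmPlaceOver L) (cmGramEntry L e dV hdV dW hdW) (imagUnit L) v₀ k') := fun k k' => ⟨fun _ => hpos k', fun _ => hpos k⟩
  have h1 : UnitaryGroup.adelicInl (Fp L) L (IsCMField.complexConj L) N M (Matrix.diagonal dV) (Matrix.diagonal dW)
        (UnitaryGroup.adelicSingle (Fp L) L (IsCMField.complexConj L) N (Matrix.diagonal dV) (IsCMField.complexConj_ne_one L)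
          (complexConj_smul_infinitePlace L) (cmPlaceOver L v₀) u) *
      UnitaryGroup.adelicInr (Fp L) L (IsCMField.complexConj L) N M (Matrix.diagonal dV) (Matrix.diagonal dW) 1 =
      placePair L dV dW v₀ u := by
    rw [MonoidHom.map_one, mul_one]
  have h : pairSplitting (Fp L) L (IsCMField.complexConj L) N M e (Matrix.diagonal dV) (Matrix.diagonal dW)
      (chiSplitting L e dV hdV hdV0 dW hdW hdW0 χ hχu hχs)
      (UnitaryGroup.adelicSingle (Fp L) L (IsCMField.complexConj L) N (Matrix.diagonal dV) (IsCMField.complexConj_ne_one L)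
          (complexConj_smul_infinitePlace L) (cmPlaceOver L v₀) u, 1) =
      chiSplitting L e dV hdV hdV0 dW hdW hdW0 χ hχu hχs (placePair L dV dW v₀ u) :=
    (pairSplitting_apply (Fp L) L (IsCMField.complexConj L) N M e (Matrix.diagonal dV) (Matrix.diagonal dW) _ _).trans
      (congrArg (chiSplitting L e dV hdV hdV0 dW hdW hdW0 χ hχu hχs) h1)
  exact ((congrArg (fun q => adelicMpCont.omega (Fp L) (Fin n) (gramA L e dV hdV dW hdW) q
    (piSchwartzBruhatEquiv (Fp L) (Fin n) (gaussianV L e dV hdV hdV0 dW hdW hdW0 ⊗ₜ f))) h).trans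
    (omega_chiSplitting_placePair_gaussianV_tmul L e dV hdV hdV0 dW hdW hdW0 v₀ hχu hχs hτ hodd u hdef f)).trans
    (congrArg (fun z : ℂ => z • piSchwartzBruhatEquiv (Fp L) (Fin n) (gaussianV L e dV hdV hdV0 dW hdW hdW0 ⊗ₜ f))
      (etaD_mul_vac_archKPlace_of_pos L e dV hdV hdV0 dW hdW hdW0 v₀ τ u hpos))

/-- **ONE DEFINITE PLACE THROUGH `pairRep … (chiSplitting χ)`, NEGATIVE sign**: `(adelicSingle (w(v₀)) u, 1)` acts on `G_𝕍 ⊗ f` by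
`((det u)^M)^{(τ_{w(v₀)}−1)/2}`. [cite: GelbartRogawski1991, §3.1 Prop. 3.1.1 p. 455] [cite: KonnoKonno2007, Lemma 5.2 p. 73] -/
theorem pairRep_chiSplitting_adelicSingle_gaussianV_tmul_of_neg {χ : HeckeCharacter L} (hχu : χ.IsUnitary) (hχs : IsSplittingChar L 1 χ)
    {τ : InfinitePlace L → ℤ} (hτ : χ.HasUnitaryArchType τ 0) (hodd : ∀ w, Odd (τ w))
    (u : UnitaryGroup.archLocal L N (Matrix.diagonal dV) (cmPlaceOver L v₀))
    (hneg : ∀ k : Fin n, ¬ 0 < signVec (cmPlaceOver L) (cmGramEntry L e dV hdV dW hdW) (imagUnit L) v₀ k) (f : FinSB (Fp L) (Fin n)) :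
    pairRep (Fp L) L (IsCMField.complexConj L) N M e (Matrix.diagonal dV) (Matrix.diagonal dW)
        (chiSplitting L e dV hdV hdV0 dW hdW hdW0 χ hχu hχs)
        (UnitaryGroup.adelicSingle (Fp L) L (IsCMField.complexConj L) N (Matrix.diagonal dV) (IsCMField.complexConj_ne_one L)
          (complexConj_smul_infinitePlace L) (cmPlaceOver L v₀) u, 1)
        (piSchwartzBruhatEquiv (Fp L) (Fin n) (gaussianV L e dV hdV hdV0 dW hdW hdW0 ⊗ₜ f)) =
      (((((u : UnitaryGroup.archLocal L N (Matrix.diagonal dV) (cmPlaceOver L v₀)) : GL (Fin N) ℂ) : Matrix (Fin N) (Fin N) ℂ).det) ^ M) ^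
        ((τ (cmPlaceOver L v₀).1 - 1) / 2) •
        piSchwartzBruhatEquiv (Fp L) (Fin n) (gaussianV L e dV hdV hdV0 dW hdW hdW0 ⊗ₜ f) := by
  have hdef : ∀ k k' : Fin n, (0 < signVec (cmPlaceOver L) (cmGramEntry L e dV hdV dW hdW) (imagUnit L) v₀ k ↔
      0 < signVec (cmPlaceOver L) (cmGramEntry L e dV hdV dW hdW) (imagUnit L) v₀ k') :=
    fun k k' => ⟨fun h => absurd h (hneg k), fun h => absurd h (hneg k')⟩
  have h1 : UnitaryGroup.adelicInl (Fp L) L (IsCMField.complexConj L) N M (Matrix.diagonal dV) (Matrix.diagonal dW)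
        (UnitaryGroup.adelicSingle (Fp L) L (IsCMField.complexConj L) N (Matrix.diagonal dV) (IsCMField.complexConj_ne_one L)
          (complexConj_smul_infinitePlace L) (cmPlaceOver L v₀) u) *
      UnitaryGroup.adelicInr (Fp L) L (IsCMField.complexConj L) N M (Matrix.diagonal dV) (Matrix.diagonal dW) 1 =
      placePair L dV dW v₀ u := by
    rw [MonoidHom.map_one, mul_one]
  have h : pairSplitting (Fp L) L (IsCMField.complexConj L) N M e (Matrix.diagonal dV) (Matrix.diagonal dW)
      (chiSplitting L e dV hdV hdV0 dW hdW hdW0 χ hχu hχs)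
      (UnitaryGroup.adelicSingle (Fp L) L (IsCMField.complexConj L) N (Matrix.diagonal dV) (IsCMField.complexConj_ne_one L)
          (complexConj_smul_infinitePlace L) (cmPlaceOver L v₀) u, 1) =
      chiSplitting L e dV hdV hdV0 dW hdW hdW0 χ hχu hχs (placePair L dV dW v₀ u) :=
    (pairSplitting_apply (Fp L) L (IsCMField.complexConj L) N M e (Matrix.diagonal dV) (Matrix.diagonal dW) _ _).trans
      (congrArg (chiSplitting L e dV hdV hdV0 dW hdW hdW0 χ hχu hχs) h1)
  exact ((congrArg (fun q => adelicMpCont.omega (Fp L) (Fin n) (gramA L e dV hdV dW hdW) q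
    (piSchwartzBruhatEquiv (Fp L) (Fin n) (gaussianV L e dV hdV hdV0 dW hdW hdW0 ⊗ₜ f))) h).trans
    (omega_chiSplitting_placePair_gaussianV_tmul L e dV hdV hdV0 dW hdW hdW0 v₀ hχu hχs hτ hodd u hdef f)).trans
    (congrArg (fun z : ℂ => z • piSchwartzBruhatEquiv (Fp L) (Fin n) (gaussianV L e dV hdV hdV0 dW hdW hdW0 ⊗ₜ f))
      (etaD_mul_vac_archKPlace_of_neg L e dV hdV hdV0 dW hdW hdW0 v₀ hodd u hneg))

end Pair

/-! ## §3 At the hermitian line `⟨T_W⟩` through `chiSplittingLine` -/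

section Line

open Literature.NumberTheory.Automorphic.Liu2021.Def411WeilCarriersDoubling (chiSplittingLine lineW complexConj_lineW lineW_ne_zero
  realDiagonal_lineW diagonal_lineW)

variable (e₁ : Fin N × Fin 1 ≃ Fin n)

/-- **ONE DEFINITE PLACE AT THE HERMITIAN LINE `⟨T_W⟩`, POSITIVE sign** (`dW := lineW T_W`; ★ `pairRep_splittingCongr_inl_one`): through
`ω_ψ ∘ ι_χ`, `ι_χ = chiSplittingLine χ T_W J_W`, the element `(adelicSingle (w(v₀)) u, 1)` acts on `G_𝕍 ⊗ f` by `(det u)^{(τ_{w(v₀)}+1)/2}`.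
[cite: GelbartRogawski1991, §3.1 Prop. 3.1.1 p. 455] [cite: KonnoKonno2007, Lemma 5.2 p. 73] [cite: Liu2021, App. D Lem. D.2 (1)] -/
theorem pairRep_chiSplittingLine_adelicSingle_gaussianV_tmul_of_pos {χ : HeckeCharacter L} (hχu : χ.IsUnitary) (hχs : IsSplittingChar L 1 χ)
    {τ : InfinitePlace L → ℤ} (hτ : χ.HasUnitaryArchType τ 0) (hodd : ∀ w, Odd (τ w))
    (TW : Matrix (Fin 1) (Fin 1) (Fp L)) (hWd : IsUnit TW.det) (JW : Matrix (Fin 1) (Fin 1) L) (hJW : JW = TW.map (algebraMap (Fp L) L))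
    (u : UnitaryGroup.archLocal L N (Matrix.diagonal dV) (cmPlaceOver L v₀))
    (hpos : ∀ k : Fin n, 0 < signVec (cmPlaceOver L) (cmGramEntry L e₁ dV hdV (lineW L TW) (complexConj_lineW L TW)) (imagUnit L) v₀ k)
    (f : FinSB (Fp L) (Fin n)) :
    pairRep (Fp L) L (IsCMField.complexConj L) N 1 e₁ (Matrix.diagonal dV) JW
        (chiSplittingLine L e₁ dV hdV hdV0 χ hχu hχs TW hWd JW hJW)
        (UnitaryGroup.adelicSingle (Fp L) L (IsCMField.complexConj L) N (Matrix.diagonal dV) (IsCMField.complexConj_ne_one L)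
          (complexConj_smul_infinitePlace L) (cmPlaceOver L v₀) u, 1)
        (piSchwartzBruhatEquiv (Fp L) (Fin n)
          (gaussianV L e₁ dV hdV hdV0 (lineW L TW) (complexConj_lineW L TW) (lineW_ne_zero L TW hWd) ⊗ₜ f)) =
      (((((u : UnitaryGroup.archLocal L N (Matrix.diagonal dV) (cmPlaceOver L v₀)) : GL (Fin N) ℂ) : Matrix (Fin N) (Fin N) ℂ).det) ^ 1) ^
        ((τ (cmPlaceOver L v₀).1 + 1) / 2) •
        piSchwartzBruhatEquiv (Fp L) (Fin n)
          (gaussianV L e₁ dV hdV hdV0 (lineW L TW) (complexConj_lineW L TW) (lineW_ne_zero L TW hWd) ⊗ₜ f) :=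
  (pairRep_splittingCongr_inl_one (IsCMField.complexConj L) e₁ (Matrix.diagonal dV) (realDiagonal_lineW L TW)
      (diagonal_lineW L TW hJW) _ _ _).trans
    (pairRep_chiSplitting_adelicSingle_gaussianV_tmul_of_pos L e₁ dV hdV hdV0 (lineW L TW) (complexConj_lineW L TW)
      (lineW_ne_zero L TW hWd) v₀ hχu hχs hτ hodd u hpos f)

/-- **ONE DEFINITE PLACE AT THE HERMITIAN LINE `⟨T_W⟩`, NEGATIVE sign**: the element `(adelicSingle (w(v₀)) u, 1)` acts on `G_𝕍 ⊗ f` by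
`(det u)^{(τ_{w(v₀)}−1)/2}`. [cite: GelbartRogawski1991, §3.1 Prop. 3.1.1 p. 455] [cite: KonnoKonno2007, Lemma 5.2 p. 73] [cite: Liu2021, App. D Lem. D.2 (1)] -/
theorem pairRep_chiSplittingLine_adelicSingle_gaussianV_tmul_of_neg {χ : HeckeCharacter L} (hχu : χ.IsUnitary) (hχs : IsSplittingChar L 1 χ)
    {τ : InfinitePlace L → ℤ} (hτ : χ.HasUnitaryArchType τ 0) (hodd : ∀ w, Odd (τ w))
    (TW : Matrix (Fin 1) (Fin 1) (Fp L)) (hWd : IsUnit TW.det) (JW : Matrix (Fin 1) (Fin 1) L) (hJW : JW = TW.map (algebraMap (Fp L) L))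
    (u : UnitaryGroup.archLocal L N (Matrix.diagonal dV) (cmPlaceOver L v₀))
    (hneg : ∀ k : Fin n, ¬ 0 < signVec (cmPlaceOver L) (cmGramEntry L e₁ dV hdV (lineW L TW) (complexConj_lineW L TW)) (imagUnit L) v₀ k)
    (f : FinSB (Fp L) (Fin n)) :
    pairRep (Fp L) L (IsCMField.complexConj L) N 1 e₁ (Matrix.diagonal dV) JW
        (chiSplittingLine L e₁ dV hdV hdV0 χ hχu hχs TW hWd JW hJW)
        (UnitaryGroup.adelicSingle (Fp L) L (IsCMField.complexConj L) N (Matrix.diagonal dV) (IsCMField.complexConj_ne_one L)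
          (complexConj_smul_infinitePlace L) (cmPlaceOver L v₀) u, 1)
        (piSchwartzBruhatEquiv (Fp L) (Fin n)
          (gaussianV L e₁ dV hdV hdV0 (lineW L TW) (complexConj_lineW L TW) (lineW_ne_zero L TW hWd) ⊗ₜ f)) =
      (((((u : UnitaryGroup.archLocal L N (Matrix.diagonal dV) (cmPlaceOver L v₀)) : GL (Fin N) ℂ) : Matrix (Fin N) (Fin N) ℂ).det) ^ 1) ^
        ((τ (cmPlaceOver L v₀).1 - 1) / 2) •
        piSchwartzBruhatEquiv (Fp L) (Fin n)
          (gaussianV L e₁ dV hdV hdV0 (lineW L TW) (complexConj_lineW L TW) (lineW_ne_zero L TW hWd) ⊗ₜ f) :=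
  (pairRep_splittingCongr_inl_one (IsCMField.complexConj L) e₁ (Matrix.diagonal dV) (realDiagonal_lineW L TW)
      (diagonal_lineW L TW hJW) _ _ _).trans
    (pairRep_chiSplitting_adelicSingle_gaussianV_tmul_of_neg L e₁ dV hdV hdV0 (lineW L TW) (complexConj_lineW L TW)
      (lineW_ne_zero L TW hWd) v₀ hχu hχs hτ hodd u hneg f)

end Line

end Literature.NumberTheory.GelbartRogawski1991.GRConstruction

end
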